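import Summits.NavierStokesRegularity.NavierStokesRegularity.Theses.PalasekTowerBreakdown
import Summits.NavierStokesRegularity.FluidComputer.PalasekTowerHandoverPressureRate

/-!
# The «slow pressure» refutation templates for `HeredityAtOne`: what their hypothesis says, and the
# continuation form

Cell `ns-blowup`, seat `ns-blowup-refuter4` (g4; LEDGER REFUTER of the route `PalasekTowerBreakdown`,
item stmt-NavierStokesRegularity-19249 `HeredityAtOne`). NEGATIVE-LANE hygiene lemmas (K68) about the
refutation templates `palasekTowerBreakdown_not_heredityAtOne_of_slowPressure` / `_slope` /
`_of_gradPressure_le` of `Theorems/PalasekTowerBreakdownHandoverRate.lean` (fc-prover-3 g3, p448550).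
LABEL: E–C typing (KERNEL bookkeeping: pure logic on top of the landed rate theorem
`Stage.exists_window_pressureRate_quiet`). WHAT THIS IS NOT: not Navier–Stokes evidence — no flow, stage
or schedule is constructed; `HeredityAtOne`-type statements are neither asserted nor refuted here; every
theorem below is an implication or an equivalence between OPEN hypotheses.

THE POINT, typed. Each template has the shape

  `(S pinned rigid quiet) → (s : registered level-1 stage) → (∀ s' : level-2 stage, s.Extends s' → SLOW s') → ¬HeredityAtOne`,

where `SLOW s'` says that at every instant of `(τ₁, τ₂]` at which the global speed maximum of `s'` lies in
the hand-over band and exceeds every earlier speed, the pressure push `−⟪u, ∇p⟫` is below the line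
`ν|Du|²_F + Λ‖u‖` (rate form), resp. `‖∇p‖ ≤ P` (gradient form), with `Λ (τ₂ − τ₁) < c₁Y₂ − c₂Y₁`.
But the rate theorem `Stage.exists_window_pressureRate_quiet` (same file family, p446972) says that EVERY
level-2 stage of a quiet schedule has such an instant with the OPPOSITE inequality. Hence, for every
registered level-1 stage `s`:

* `Stage.not_slowPressure_window` — no stage of level `≥ j+1` (`j ≥ 1`, quiet schedule, any rates, any
  margins, any `ν > 0`) satisfies the slow-pressure clause on the window `j → j+1`; likewise
  `Stage.not_gradPressure_le_window` for the gradient clause;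
* **`slowPressureTemplate_iff_noExtension`**, `…_slope_iff_noExtension`, `gradPressureTemplate_iff_noExtension`
  — the template hypothesis `∀ s', s.Extends s' → SLOW s'` is EQUIVALENT to `∀ s', ¬ s.Extends s'`
  («`s` has no registered level-2 extension»), with NO use of `Pins`;
* `not_heredityAtOne_iff_exists_noExtension` — and `¬HeredityAtOne` is, by its definition, EXACTLY the
  existence of a pinned rigid quiet wide schedule with a registered level-1 stage without extension.

So the three templates are `¬HeredityAtOne ← (its own defining counterexample)` with the counterexample
clause rewritten through the rate theorem: as typed, their rate hypothesis is dischargeable for a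
concrete `(S, s)` only by an estimate along the flow that, via W14 uniqueness, transports to every
registered `s'`. The W14-free form a disprover can aim at directly is the CONTINUATION form, landed here:

* **`not_heredityAtOne_of_slowPressure_continuation`** — ONE pinned rigid quiet wide schedule and ONE
  registered level-1 stage `s` such that EVERY finite-energy classical continuation `(u, p)` of `s` to
  `[0, τ₂]` (same force; `u, p` agree with `s` on `[0, τ₁]`) pushes slower than `|Du|²_F + Λ‖u‖` at its
  running speed maxima in the band `((5/3)Y₁, Y₂]`, for some `0 ≤ Λ` with `Λ(τ₂ − τ₁) < Y₂ − (5/3)Y₁`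
  (e.g. `Λ = 2.74·10⁷`, `…_num`), refutes `HeredityAtOne`; `not_heredityAtOne_of_gradPressure_le_continuation`
  — the same from `‖∇p‖ ≤ P` at those maxima with `P(τ₂ − τ₁) < Y₂ − (5/3)Y₁`. The hypothesis speaks about
  the actual continuation of `s` (a registered `s'` IS one, by its fields `classical`/`energy` and
  `Stage.Extends`), is not refuted by any tree theorem, and is vacuous only if `s` has no finite-energy
  classical continuation to `τ₂` at all — in which case `s` is already the counterexample.

VACUITY WARNING (unchanged, K61/KJ-10 of record): every theorem here needs a REGISTERED LEVEL-1 STAGE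
`s`; none is known (R2-hard), so nothing here bites item 19249 today.

References: S. Palasek, arXiv:2605.13827 §3.3, §4 (the tower's hand-over) [cite: Palasek2026ElementaryModel, §4];
T. Tao, Anal. PDE 6 (2013), Cor. 11.4 (the uniqueness the `s'`-form silently needs) [cite: Tao2011, Cor. 11.4].
-/

noncomputable section

namespace Summit.NavierStokesRegularity.HeredityAtOneSlowPressure

open Set MeasureTheory
open scoped ENNReal InnerProductSpace RealInnerProductSpace
open Summit.NavierStokesRegularity.NavierStokesRegularity.Theses
open Summit.NavierStokesRegularity.FluidComputer.PalasekTowerClayBridge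
open Literature.Analysis.FluidPDE

/-! ## §1 No registered stage is «slow» on a silent window -/

/-- **No stage satisfies the slow-pressure clause on a silent window.** For a quiet schedule (any rates,
any margins, any `ν > 0`), a registered stage of level `k ≥ j+1`, `j ≥ 1`, and any slope `0 ≤ Λ` with
`Λ(τ_{j+1} − τ_j) < c₁Y_{j+1} − c₂Y_j`, it is FALSE that the pressure push stays below
`ν|Du|²_F + Λ‖u‖` at every running global speed maximum in the band `(c₂Y_j, c₁Y_{j+1}]` of the window
`(τ_j, τ_{j+1}]`: `Stage.exists_window_pressureRate_quiet` produces an instant with the opposite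
inequality. [cite: Palasek2026ElementaryModel, §4] -/
theorem Stage.not_slowPressure_window {ν : ℝ} {R : TowerRates} {S : Schedule R} {m : Margins R}
    {k : ℕ} (hν : 0 < ν) (s : Stage ν R S m k) (hQ : S.Quiet) {j : ℕ} (hj1 : 1 ≤ j) (hj : j + 1 ≤ k)
    {Λ : ℝ} (hΛ0 : 0 ≤ Λ) (hΛ : Λ * (S.τ (j + 1) - S.τ j) < S.c₁ * R.Y (j + 1) - S.c₂ * R.Y j) :
    ¬ ∀ t ∈ Ioc (S.τ j) (S.τ (j + 1)), ∀ x : EuclideanSpace ℝ (Fin 3),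
        (∀ y, ‖s.u t y‖ ≤ ‖s.u t x‖) →
        S.c₂ * R.Y j < ‖s.u t x‖ → ‖s.u t x‖ ≤ S.c₁ * R.Y (j + 1) →
        (∀ t' ∈ Ico 0 t, ∀ y, ‖s.u t' y‖ < ‖s.u t x‖) →
        - ⟪s.u t x, gradient (s.p t) x⟫ <
          ν * frobeniusNormSq (fderiv ℝ (s.u t) x) + Λ * ‖s.u t x‖ := by
  intro h
  obtain ⟨t₀, ht₀, x₀, -, hlow, hupp, hmax, hstrict, -, hPr, -⟩ :=
    s.exists_window_pressureRate_quiet hν hQ hj1 hj hΛ0 hΛ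
  have hlt := h t₀ ht₀ x₀ hmax hlow hupp hstrict
  linarith

/-- **No stage satisfies the pressure-gradient clause on a silent window.** Same setting; for any
`0 ≤ P` with `P(τ_{j+1} − τ_j) < c₁Y_{j+1} − c₂Y_j` it is FALSE that `‖∇p‖ ≤ P` at every running global
speed maximum in the band: the rate theorem gives an instant with `‖∇p‖ ≥ Λ` for a slope `Λ > P` still
under the jump. [cite: Palasek2026ElementaryModel, §4] -/
theorem Stage.not_gradPressure_le_window {ν : ℝ} {R : TowerRates} {S : Schedule R} {m : Margins R}
    {k : ℕ} (hν : 0 < ν) (s : Stage ν R S m k) (hQ : S.Quiet) {j : ℕ} (hj1 : 1 ≤ j) (hj : j + 1 ≤ k)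
    {P : ℝ} (hP0 : 0 ≤ P) (hP : P * (S.τ (j + 1) - S.τ j) < S.c₁ * R.Y (j + 1) - S.c₂ * R.Y j) :
    ¬ ∀ t ∈ Ioc (S.τ j) (S.τ (j + 1)), ∀ x : EuclideanSpace ℝ (Fin 3),
        (∀ y, ‖s.u t y‖ ≤ ‖s.u t x‖) →
        S.c₂ * R.Y j < ‖s.u t x‖ → ‖s.u t x‖ ≤ S.c₁ * R.Y (j + 1) →
        (∀ t' ∈ Ico 0 t, ∀ y, ‖s.u t' y‖ < ‖s.u t x‖) →
        ‖gradient (s.p t) x‖ ≤ P := by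
  intro h
  have hw : 0 < S.τ (j + 1) - S.τ j := by linarith [S.τ_lt_succ j]
  -- a slope strictly between `P` and the mean rate
  set Λ : ℝ := (P + (S.c₁ * R.Y (j + 1) - S.c₂ * R.Y j) / (S.τ (j + 1) - S.τ j)) / 2 with hΛdef
  have hPlt : P < (S.c₁ * R.Y (j + 1) - S.c₂ * R.Y j) / (S.τ (j + 1) - S.τ j) :=
    (lt_div_iff₀ hw).2 hP
  have hPΛ : P < Λ := by rw [hΛdef]; linarith
  have hΛ0 : 0 ≤ Λ := le_trans hP0 hPΛ.le
  have hΛlt : Λ < (S.c₁ * R.Y (j + 1) - S.c₂ * R.Y j) / (S.τ (j + 1) - S.τ j) := by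
    rw [hΛdef]; linarith
  have hΛ : Λ * (S.τ (j + 1) - S.τ j) < S.c₁ * R.Y (j + 1) - S.c₂ * R.Y j :=
    (lt_div_iff₀ hw).1 hΛlt
  obtain ⟨t₀, ht₀, x₀, -, hlow, hupp, hmax, hstrict, -, -, hgrad⟩ :=
    s.exists_window_pressureRate_quiet hν hQ hj1 hj hΛ0 hΛ
  have hle := h t₀ ht₀ x₀ hmax hlow hupp hstrict
  linarith

/-! ## §2 The template hypothesis is «no extension» -/

variable (S : Schedule TowerRates.wide)

/-- **The rate-form template hypothesis says exactly «`s` has no registered level-2 extension».** For a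
rigid quiet wide schedule and a registered level-1 stage `s` (route-G margins, unit viscosity), the
hypothesis of `palasekTowerBreakdown_not_heredityAtOne_of_slowPressure` — every level-2 stage extending
`s` pushes slower than `|Du|²_F + 2.74·10⁷‖u‖` at its running speed maxima in `((5/3)Y₁, Y₂]` — holds
iff NO level-2 stage extends `s`. `Pins` is not used. [cite: Palasek2026ElementaryModel, §4] -/
theorem slowPressureTemplate_iff_noExtension (hR : S.Rigid) (hQ : S.Quiet)
    (s : Stage 1 TowerRates.wide S (Margins.routeG TowerRates.wide) 1) :
    (∀ s' : Stage 1 TowerRates.wide S (Margins.routeG TowerRates.wide) 2, s.Extends s' →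
      ∀ t ∈ Ioc (S.τ 1) (S.τ 2), ∀ x : EuclideanSpace ℝ (Fin 3),
        (∀ y, ‖s'.u t y‖ ≤ ‖s'.u t x‖) →
        S.c₂ * TowerRates.wide.Y 1 < ‖s'.u t x‖ → ‖s'.u t x‖ ≤ S.c₁ * TowerRates.wide.Y 2 →
        (∀ t' ∈ Ico 0 t, ∀ y, ‖s'.u t' y‖ < ‖s'.u t x‖) →
        - ⟪s'.u t x, gradient (s'.p t) x⟫ <
          1 * frobeniusNormSq (fderiv ℝ (s'.u t) x) + 27400000 * ‖s'.u t x‖) ↔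
    ∀ s' : Stage 1 TowerRates.wide S (Margins.routeG TowerRates.wide) 2, ¬ s.Extends s' := by
  obtain ⟨hrate, -⟩ := hR.handoverRate_one_bounds
  have hw : 0 < S.τ 2 - S.τ 1 := by linarith [S.τ_lt_succ 1]
  have hΛ : (27400000 : ℝ) * (S.τ (1 + 1) - S.τ 1) <
      S.c₁ * TowerRates.wide.Y (1 + 1) - S.c₂ * TowerRates.wide.Y 1 := by
    rw [show (1 : ℕ) + 1 = 2 from rfl]; exact (lt_div_iff₀ hw).1 hrate
  constructor
  · intro h s' hs'
    have hnot := Stage.not_slowPressure_window one_pos s' hQ (j := 1) le_rfl le_rfl (by norm_num) hΛ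
    rw [show (1 : ℕ) + 1 = 2 from rfl] at hnot
    exact hnot (h s' hs')
  · intro h s' hs'
    exact absurd hs' (h s')

/-- **The general-slope template hypothesis says exactly «no extension».** Same, for the hypothesis of
`palasekTowerBreakdown_not_heredityAtOne_of_slowPressure_slope`: any `0 ≤ Λ` with
`Λ(τ₂ − τ₁) < c₁Y₂ − c₂Y₁`. [cite: Palasek2026ElementaryModel, §4] -/
theorem slowPressureTemplate_slope_iff_noExtension (hQ : S.Quiet)
    (s : Stage 1 TowerRates.wide S (Margins.routeG TowerRates.wide) 1) {Λ : ℝ} (hΛ0 : 0 ≤ Λ)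
    (hΛ : Λ * (S.τ 2 - S.τ 1) < S.c₁ * TowerRates.wide.Y 2 - S.c₂ * TowerRates.wide.Y 1) :
    (∀ s' : Stage 1 TowerRates.wide S (Margins.routeG TowerRates.wide) 2, s.Extends s' →
      ∀ t ∈ Ioc (S.τ 1) (S.τ 2), ∀ x : EuclideanSpace ℝ (Fin 3),
        (∀ y, ‖s'.u t y‖ ≤ ‖s'.u t x‖) →
        S.c₂ * TowerRates.wide.Y 1 < ‖s'.u t x‖ → ‖s'.u t x‖ ≤ S.c₁ * TowerRates.wide.Y 2 →
        (∀ t' ∈ Ico 0 t, ∀ y, ‖s'.u t' y‖ < ‖s'.u t x‖) →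
        - ⟪s'.u t x, gradient (s'.p t) x⟫ <
          1 * frobeniusNormSq (fderiv ℝ (s'.u t) x) + Λ * ‖s'.u t x‖) ↔
    ∀ s' : Stage 1 TowerRates.wide S (Margins.routeG TowerRates.wide) 2, ¬ s.Extends s' := by
  have hΛ' : Λ * (S.τ (1 + 1) - S.τ 1) <
      S.c₁ * TowerRates.wide.Y (1 + 1) - S.c₂ * TowerRates.wide.Y 1 := by
    rw [show (1 : ℕ) + 1 = 2 from rfl]; exact hΛ
  constructor
  · intro h s' hs'
    have hnot := Stage.not_slowPressure_window one_pos s' hQ (j := 1) le_rfl le_rfl hΛ0 hΛ'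
    rw [show (1 : ℕ) + 1 = 2 from rfl] at hnot
    exact hnot (h s' hs')
  · intro h s' hs'
    exact absurd hs' (h s')

/-- **The gradient-form template hypothesis says exactly «no extension».** Same, for the hypothesis of
`palasekTowerBreakdown_not_heredityAtOne_of_gradPressure_le`: any `0 ≤ P` with
`P(τ₂ − τ₁) < c₁Y₂ − c₂Y₁`. [cite: Palasek2026ElementaryModel, §4] -/
theorem gradPressureTemplate_iff_noExtension (hQ : S.Quiet)
    (s : Stage 1 TowerRates.wide S (Margins.routeG TowerRates.wide) 1) {P : ℝ} (hP0 : 0 ≤ P)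
    (hP : P * (S.τ 2 - S.τ 1) < S.c₁ * TowerRates.wide.Y 2 - S.c₂ * TowerRates.wide.Y 1) :
    (∀ s' : Stage 1 TowerRates.wide S (Margins.routeG TowerRates.wide) 2, s.Extends s' →
      ∀ t ∈ Ioc (S.τ 1) (S.τ 2), ∀ x : EuclideanSpace ℝ (Fin 3),
        (∀ y, ‖s'.u t y‖ ≤ ‖s'.u t x‖) →
        S.c₂ * TowerRates.wide.Y 1 < ‖s'.u t x‖ → ‖s'.u t x‖ ≤ S.c₁ * TowerRates.wide.Y 2 →
        (∀ t' ∈ Ico 0 t, ∀ y, ‖s'.u t' y‖ < ‖s'.u t x‖) →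
        ‖gradient (s'.p t) x‖ ≤ P) ↔
    ∀ s' : Stage 1 TowerRates.wide S (Margins.routeG TowerRates.wide) 2, ¬ s.Extends s' := by
  have hP' : P * (S.τ (1 + 1) - S.τ 1) <
      S.c₁ * TowerRates.wide.Y (1 + 1) - S.c₂ * TowerRates.wide.Y 1 := by
    rw [show (1 : ℕ) + 1 = 2 from rfl]; exact hP
  constructor
  · intro h s' hs'
    have hnot := Stage.not_gradPressure_le_window one_pos s' hQ (j := 1) le_rfl le_rfl hP0 hP'
    rw [show (1 : ℕ) + 1 = 2 from rfl] at hnot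
    exact hnot (h s' hs')
  · intro h s' hs'
    exact absurd hs' (h s')

/-- **`¬HeredityAtOne` is, by definition, the existence of a registered level-1 stage without
extension** (pinned `Λ = 8`, `θ = 6/5`, rigid, quiet, wide rates, route-G margins, unit viscosity).
Pure logic; recorded so that the templates above read as what they are. [folklore] -/
theorem not_heredityAtOne_iff_exists_noExtension :
    ¬ PalasekTowerBreakdown.HeredityAtOne ↔
      ∃ S : Schedule TowerRates.wide, S.Pins 8 (6 / 5) ∧ S.Rigid ∧ S.Quiet ∧
        ∃ s : Stage 1 TowerRates.wide S (Margins.routeG TowerRates.wide) 1,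
          ∀ s' : Stage 1 TowerRates.wide S (Margins.routeG TowerRates.wide) 2, ¬ s.Extends s' := by
  constructor
  · intro h
    by_contra hne
    apply h
    intro S hP hR hQ s
    by_contra hs
    exact hne ⟨S, hP, hR, hQ, s, fun s' hs' => hs ⟨s', hs'⟩⟩
  · rintro ⟨S, hP, hR, hQ, s, hs⟩ hH
    obtain ⟨s', hs'⟩ := hH S hP hR hQ s
    exact hs s' hs'

/-- The template with its hypothesis un-dressed: ONE pinned rigid quiet wide schedule with ONE
registered level-1 stage that no level-2 stage extends refutes `HeredityAtOne`. (This is the content of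
`palasekTowerBreakdown_not_heredityAtOne_of_slowPressure` once `slowPressureTemplate_iff_noExtension`
rewrites its hypothesis.) [folklore] -/
theorem not_heredityAtOne_of_noExtension (hP : S.Pins 8 (6 / 5)) (hR : S.Rigid) (hQ : S.Quiet)
    (s : Stage 1 TowerRates.wide S (Margins.routeG TowerRates.wide) 1)
    (h : ∀ s' : Stage 1 TowerRates.wide S (Margins.routeG TowerRates.wide) 2, ¬ s.Extends s') :
    ¬ PalasekTowerBreakdown.HeredityAtOne :=
  not_heredityAtOne_iff_exists_noExtension.2 ⟨S, hP, hR, hQ, s, h⟩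

/-! ## §3 The continuation form (W14-free) -/

/-- **REFUTATION TEMPLATE, CONTINUATION FORM.** ONE pinned (`Λ = 8`, `θ = 6/5`) rigid quiet wide
schedule and ONE globally anchored registered level-1 stage `s` such that EVERY finite-energy classical
continuation `(u, p)` of `s` to `[0, τ₂]` (forced by `S.f`, agreeing with `s.u, s.p` on `[0, τ₁]`) has,
at every instant of `(τ₁, τ₂]` where its global speed maximum lies in `((5/3)Y₁, Y₂]` and exceeds every
earlier speed, pressure push `−⟪u, ∇p⟫ < |Du|²_F + Λ‖u‖` for a slope `0 ≤ Λ` with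
`Λ(τ₂ − τ₁) < Y₂ − (5/3)Y₁`, refutes `HeredityAtOne`: a level-2 extension `s'` would be such a
continuation (fields `classical`, `energy`, and `Stage.Extends`), and `Stage.exists_window_pressureRate_quiet`
gives it a fast instant. No uniqueness theorem is used. VACUITY: needs a registered level-1 stage.
[cite: Palasek2026ElementaryModel, §4] -/
theorem not_heredityAtOne_of_slowPressure_continuation (hP : S.Pins 8 (6 / 5)) (hR : S.Rigid)
    (hQ : S.Quiet) (s : Stage 1 TowerRates.wide S (Margins.routeG TowerRates.wide) 1) {Λ : ℝ}
    (hΛ0 : 0 ≤ Λ) (hΛ : Λ * (S.τ 2 - S.τ 1) < S.c₁ * TowerRates.wide.Y 2 - S.c₂ * TowerRates.wide.Y 1)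
    (h : ∀ (u : ℝ → EuclideanSpace ℝ (Fin 3) → EuclideanSpace ℝ (Fin 3))
        (p : ℝ → EuclideanSpace ℝ (Fin 3) → ℝ),
        IsClassicalNSSolutionOn (Icc 0 (S.τ 2)) 1 S.f u p →
        (∀ t ∈ Icc 0 (S.τ 1), u t = s.u t ∧ p t = s.p t) →
        (∃ C : ℝ≥0∞, C < ⊤ ∧ ∀ t ∈ Icc 0 (S.τ 2), ∫⁻ x, ‖u t x‖ₑ ^ 2 ≤ C) →
        ∀ t ∈ Ioc (S.τ 1) (S.τ 2), ∀ x : EuclideanSpace ℝ (Fin 3),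
          (∀ y, ‖u t y‖ ≤ ‖u t x‖) →
          S.c₂ * TowerRates.wide.Y 1 < ‖u t x‖ → ‖u t x‖ ≤ S.c₁ * TowerRates.wide.Y 2 →
          (∀ t' ∈ Ico 0 t, ∀ y, ‖u t' y‖ < ‖u t x‖) →
          - ⟪u t x, gradient (p t) x⟫ < 1 * frobeniusNormSq (fderiv ℝ (u t) x) + Λ * ‖u t x‖) :
    ¬ PalasekTowerBreakdown.HeredityAtOne := by
  intro hH
  obtain ⟨s', hs'⟩ := hH S hP hR hQ s
  have hslow := h s'.u s'.p s'.classical hs' s'.energy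
  have hΛ' : Λ * (S.τ (1 + 1) - S.τ 1) <
      S.c₁ * TowerRates.wide.Y (1 + 1) - S.c₂ * TowerRates.wide.Y 1 := by
    rw [show (1 : ℕ) + 1 = 2 from rfl]; exact hΛ
  have hnot := Stage.not_slowPressure_window one_pos s' hQ (j := 1) le_rfl le_rfl hΛ0 hΛ'
  rw [show (1 : ℕ) + 1 = 2 from rfl] at hnot
  exact hnot hslow

/-- **Continuation-form template at the number of record** `Λ = 2.74·10⁷` (admissible by
`Schedule.Rigid.handoverRate_one_bounds`). [cite: Palasek2026ElementaryModel, §4] -/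
theorem not_heredityAtOne_of_slowPressure_continuation_num (hP : S.Pins 8 (6 / 5)) (hR : S.Rigid)
    (hQ : S.Quiet) (s : Stage 1 TowerRates.wide S (Margins.routeG TowerRates.wide) 1)
    (h : ∀ (u : ℝ → EuclideanSpace ℝ (Fin 3) → EuclideanSpace ℝ (Fin 3))
        (p : ℝ → EuclideanSpace ℝ (Fin 3) → ℝ),
        IsClassicalNSSolutionOn (Icc 0 (S.τ 2)) 1 S.f u p →
        (∀ t ∈ Icc 0 (S.τ 1), u t = s.u t ∧ p t = s.p t) →
        (∃ C : ℝ≥0∞, C < ⊤ ∧ ∀ t ∈ Icc 0 (S.τ 2), ∫⁻ x, ‖u t x‖ₑ ^ 2 ≤ C) →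
        ∀ t ∈ Ioc (S.τ 1) (S.τ 2), ∀ x : EuclideanSpace ℝ (Fin 3),
          (∀ y, ‖u t y‖ ≤ ‖u t x‖) →
          S.c₂ * TowerRates.wide.Y 1 < ‖u t x‖ → ‖u t x‖ ≤ S.c₁ * TowerRates.wide.Y 2 →
          (∀ t' ∈ Ico 0 t, ∀ y, ‖u t' y‖ < ‖u t x‖) →
          - ⟪u t x, gradient (p t) x⟫ <
            1 * frobeniusNormSq (fderiv ℝ (u t) x) + 27400000 * ‖u t x‖) :
    ¬ PalasekTowerBreakdown.HeredityAtOne := by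
  obtain ⟨hrate, -⟩ := hR.handoverRate_one_bounds
  have hw : 0 < S.τ 2 - S.τ 1 := by linarith [S.τ_lt_succ 1]
  exact not_heredityAtOne_of_slowPressure_continuation S hP hR hQ s (by norm_num)
    ((lt_div_iff₀ hw).1 hrate) h

/-- **REFUTATION TEMPLATE, CONTINUATION FORM, pressure-gradient version.** Same, from a bound
`‖∇p‖ ≤ P` at the running speed maxima of every finite-energy classical continuation of `s` to
`[0, τ₂]`, with `0 ≤ P` and `P(τ₂ − τ₁) < Y₂ − (5/3)Y₁` (time to hand over `> τ₂ − τ₁`).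
[cite: Palasek2026ElementaryModel, §4] -/
theorem not_heredityAtOne_of_gradPressure_le_continuation (hP : S.Pins 8 (6 / 5)) (hR : S.Rigid)
    (hQ : S.Quiet) (s : Stage 1 TowerRates.wide S (Margins.routeG TowerRates.wide) 1) {P : ℝ}
    (hP0 : 0 ≤ P) (hPw : P * (S.τ 2 - S.τ 1) < S.c₁ * TowerRates.wide.Y 2 - S.c₂ * TowerRates.wide.Y 1)
    (h : ∀ (u : ℝ → EuclideanSpace ℝ (Fin 3) → EuclideanSpace ℝ (Fin 3))
        (p : ℝ → EuclideanSpace ℝ (Fin 3) → ℝ),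
        IsClassicalNSSolutionOn (Icc 0 (S.τ 2)) 1 S.f u p →
        (∀ t ∈ Icc 0 (S.τ 1), u t = s.u t ∧ p t = s.p t) →
        (∃ C : ℝ≥0∞, C < ⊤ ∧ ∀ t ∈ Icc 0 (S.τ 2), ∫⁻ x, ‖u t x‖ₑ ^ 2 ≤ C) →
        ∀ t ∈ Ioc (S.τ 1) (S.τ 2), ∀ x : EuclideanSpace ℝ (Fin 3),
          (∀ y, ‖u t y‖ ≤ ‖u t x‖) →
          S.c₂ * TowerRates.wide.Y 1 < ‖u t x‖ → ‖u t x‖ ≤ S.c₁ * TowerRates.wide.Y 2 →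
          (∀ t' ∈ Ico 0 t, ∀ y, ‖u t' y‖ < ‖u t x‖) → ‖gradient (p t) x‖ ≤ P) :
    ¬ PalasekTowerBreakdown.HeredityAtOne := by
  intro hH
  obtain ⟨s', hs'⟩ := hH S hP hR hQ s
  have hle := h s'.u s'.p s'.classical hs' s'.energy
  have hP' : P * (S.τ (1 + 1) - S.τ 1) <
      S.c₁ * TowerRates.wide.Y (1 + 1) - S.c₂ * TowerRates.wide.Y 1 := by
    rw [show (1 : ℕ) + 1 = 2 from rfl]; exact hPw
  have hnot := Stage.not_gradPressure_le_window one_pos s' hQ (j := 1) le_rfl le_rfl hP0 hP'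
  rw [show (1 : ℕ) + 1 = 2 from rfl] at hnot
  exact hnot hle

end Summit.NavierStokesRegularity.HeredityAtOneSlowPressure

end
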